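import Summits.AtomisticToContinuum.HydrodynamicLimit.Theorems.LambertianContactSwapLambertianEulerTwoTimeLaw
import Summits.AtomisticToContinuum.HydrodynamicLimit.Theorems.OneFlightGossipEngineClampedCurrentsDockPathwise
import Literature.Analysis.FunctionSpaces.TorusCalculusProofs
import Literature.MathematicalPhysics.KineticTheory.LambertianRedrawNondegenerate
import HarnessLib

/-!
# Tools for the expected one-window entropy production of the Lambertian gas
# (crux `LambertianEuler`, stmt-AtomisticToContinuum-11854, line `Sketch`; helpers of the stub `stub_expectedWindowProductionLambda`)

Helper file (`--supports`) of the crux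
`Summit.AtomisticToContinuum.HydrodynamicLimit.Theses.LindebergRandomFuture.LambertianEuler`, line `Sketch`.
Three dynamics-light tools used by the FORMULA stub `stub_expectedWindowProductionLambda` (the expected
window entropy production of the Lambertian gas `Λ` as an explicit functional):

* `exists_abs_gExp_le_of_window` — the one-body local-Gibbs exponent
  `g_t(x, v) = log a_t(x) − (3/2) log(2π θ_t(x)) − |v − u_t(x)|²/(2θ_t(x))`
  (`ClampedCurrentsDockPathwise.gExp`) of a reference family with profiles jointly smooth on `[0, T)`,
  `a, θ > 0`, grows at most quadratically in the velocity UNIFORMLY over a compact time window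
  `[s, s+h] ⊆ [0, T)` (continuity of the lifted profiles on `[s, s+h] × [0,1]³`); summed,
  `|Σ_i g_t(w_i)| ≤ C (1 + E(w))` (`abs_gSum_le_of_window`).
* `continuous_gSum_clamp` / `measurable_uncurry_gSum_clamp` — the observable `(t, w) ↦ Σ_i g_{c(t)}(w_i)`
  with the time clamped to the window, `c(t) = max s (min t (s+h))`, is jointly continuous, hence jointly
  measurable (the clamped profiles are continuous on `ℝ × 𝕋³`, `id × proj` being an open quotient map) —
  the observable fed to the collision compensator.
* `integral_twoTime_eq` — the two-time Markov law of `Λ` (`…LambertianEulerTwoTimeLaw.stub_twoTimeLawLambda`)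
  in Bochner form: for a real measurable `F` on pairs of states,
  `∫ F(q, Λ_h(q, ηs)) d(μ_s ⊗ γ^ℕ) = ∫ F(Λ_s, Λ_{s+h}) d(P ⊗ γ^ℕ)`, `μ_s = (P ⊗ γ^ℕ) ∘ Λ_s⁻¹`
  (equality of the two joint laws, then `integral_map` on both sides; no integrability needed).
* `measurable_sum_range_real` — sums over a measurable random range are measurable.

References: H.-T. Yau, Lett. Math. Phys. 22 (1991) §2 (bookkeeping of the relative-entropy method);
the rest is measure theory. All `[folklore]`.
-/

noncomputable section

namespace Summit.AtomisticToContinuum.HydrodynamicLimit.Theorems.LambertianContactSwapLambertianEulerExpectedWindowProductionTools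

open scoped BigOperators Topology ENNReal InnerProductSpace
open MeasureTheory ProbabilityTheory Filter Set InformationTheory
open Literature.MathematicalPhysics.KineticTheory
open Literature.Analysis.FluidPDE Literature.Analysis.FluidPDE.Alexander
open Literature.Analysis.FunctionSpaces
open Summit.AtomisticToContinuum.HydrodynamicLimit.Theorems.ClampedCurrentsDockPathwise (gExp gSum)

/-! ## §1 Sums over a measurable random range -/

/-- A sum over `Finset.range (K p)` of measurable real terms, `K` measurable, is measurable. [folklore] -/
theorem measurable_sum_range_real {α : Type*} [MeasurableSpace α] {K : α → ℕ} (hK : Measurable K)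
    {f : ℕ → α → ℝ} (hf : ∀ m, Measurable (f m)) : Measurable fun p => ∑ m ∈ Finset.range (K p), f m p := by
  have h : Measurable fun q : α × ℕ => ∑ m ∈ Finset.range q.2, f m q.1 := by
    refine measurable_from_prod_countable_left fun k => ?_
    exact Finset.measurable_sum (Finset.range k) fun m _ => hf m
  exact h.comp (measurable_id.prodMk hK)

/-- `|Σ_{m<K} f m| ≤ K · D` when every term is bounded by `D`. [folklore] -/
theorem abs_sum_range_le_mul {K : ℕ} {f : ℕ → ℝ} {D : ℝ} (h : ∀ m, |f m| ≤ D) :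
    |∑ m ∈ Finset.range K, f m| ≤ (K : ℝ) * D :=
  (Finset.abs_sum_le_sum_abs _ _).trans ((Finset.sum_le_sum fun m _ => h m).trans
    (by rw [Finset.sum_const, Finset.card_range, nsmul_eq_mul]))

/-! ## §2 The one-body exponent on a compact time window -/

section Window

variable {T : ℝ} {a θ : ℝ → T3 → ℝ} {u : ℝ → T3 → V3}

/-- A lifted field continuous on `[0, T) × ℝ³` is bounded on `[s, s+h] × 𝕋³` for `[s, s+h] ⊆ [0, T)`
(compactness of `[s, s+h] × [0,1]³` and `proj ∘ repr = id`). [folklore] -/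
theorem exists_norm_le_of_continuousOn_window {F : Type*} [NormedAddCommGroup F] {f : ℝ × V3 → F}
    (hf : ContinuousOn f (Ico 0 T ×ˢ univ)) {s h : ℝ} (hs : 0 ≤ s) (hshT : s + h < T) :
    ∃ C : ℝ, 0 ≤ C ∧ ∀ t ∈ Icc s (s + h), ∀ x : T3, ‖f (t, Torus.repr x)‖ ≤ C := by
  have hKS : Icc s (s + h) ⊆ Ico 0 T := fun r hr => ⟨hs.trans hr.1, hr.2.trans_lt hshT⟩
  have hc : ContinuousOn f (Icc s (s + h) ×ˢ ((WithLp.toLp 2) '' (Set.pi univ fun _ : Fin 3 => Icc (0 : ℝ) 1))) :=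
    hf.mono (prod_mono hKS (subset_univ _))
  obtain ⟨C, hC⟩ := (isCompact_Icc.prod Torus.isCompact_toLp_image_pi_Icc).exists_bound_of_continuousOn hc
  exact ⟨max C 0, le_max_right _ _, fun t ht x =>
    (hC _ (mk_mem_prod ht (Torus.repr_mem_toLp_image_pi_Icc x))).trans (le_max_left _ _)⟩

/-- **Uniform quadratic growth of the one-body exponent over a compact time window**: for profiles jointly
smooth on `[0, T)` with `a, θ > 0` and `[s, s+h] ⊆ [0, T)` there is `C ≥ 0` with
`|g_t(x, v)| ≤ C (1 + |v|²)` for all `t ∈ [s, s+h]`, `x`, `v` (`|log a|`, `|log 2πθ|`, `θ⁻¹`, `|u|` are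
bounded there). [folklore] -/
theorem exists_abs_gExp_le_of_window (ha : Torus.IsSmoothSpaceTimeOn (Ico 0 T) a)
    (hθ : Torus.IsSmoothSpaceTimeOn (Ico 0 T) θ) (hu : Torus.IsSmoothSpaceTimeOn (Ico 0 T) u)
    (ha0 : ∀ t ∈ Ico 0 T, ∀ x, 0 < a t x) (hθ0 : ∀ t ∈ Ico 0 T, ∀ x, 0 < θ t x) {s h : ℝ}
    (hs : 0 ≤ s) (hshT : s + h < T) :
    ∃ C : ℝ, 0 ≤ C ∧ ∀ t ∈ Icc s (s + h), ∀ (x : T3) (v : V3), |gExp a θ u t (x, v)| ≤ C * (1 + ‖v‖ ^ 2) := by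
  have hKS : Icc s (s + h) ⊆ Ico 0 T := fun r hr => ⟨hs.trans hr.1, hr.2.trans_lt hshT⟩
  have hapos : ∀ p ∈ Ico 0 T ×ˢ (univ : Set V3), Torus.stLift a p ≠ 0 := fun p hp =>
    (ha0 p.1 (mem_prod.1 hp).1 _).ne'
  have hθpos : ∀ p ∈ Ico 0 T ×ˢ (univ : Set V3), Torus.stLift θ p ≠ 0 := fun p hp =>
    (hθ0 p.1 (mem_prod.1 hp).1 _).ne'
  have h2θ : ∀ p ∈ Ico 0 T ×ˢ (univ : Set V3), 2 * Real.pi * Torus.stLift θ p ≠ 0 := fun p hp =>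
    mul_ne_zero (mul_ne_zero two_ne_zero Real.pi_pos.ne') (hθpos p hp)
  obtain ⟨B₁, hB₁, h₁⟩ := exists_norm_le_of_continuousOn_window (ha.continuousOn_stLift.log hapos) hs hshT
  obtain ⟨B₂, hB₂, h₂⟩ := exists_norm_le_of_continuousOn_window
    ((continuousOn_const.mul hθ.continuousOn_stLift).log h2θ) hs hshT
  obtain ⟨B₃, hB₃, h₃⟩ := exists_norm_le_of_continuousOn_window (hθ.continuousOn_stLift.inv₀ hθpos) hs hshT
  obtain ⟨W, hW, h₄⟩ := exists_norm_le_of_continuousOn_window hu.continuousOn_stLift.norm hs hshT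
  refine ⟨B₁ + 3 / 2 * B₂ + W ^ 2 * B₃ + B₃, by positivity, fun t ht x v => ?_⟩
  have htS : t ∈ Ico 0 T := hKS ht
  have hθx : 0 < θ t x := hθ0 t htS x
  have e₁ : Torus.stLift a (t, Torus.repr x) = a t x := by rw [Torus.stLift_apply, Torus.proj_repr]
  have e₂ : Torus.stLift θ (t, Torus.repr x) = θ t x := by rw [Torus.stLift_apply, Torus.proj_repr]
  have e₃ : Torus.stLift u (t, Torus.repr x) = u t x := by rw [Torus.stLift_apply, Torus.proj_repr]
  have hl₁ : |Real.log (a t x)| ≤ B₁ := by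
    have h := h₁ t ht x; rwa [Real.norm_eq_abs, e₁] at h
  have hl₂ : |Real.log (2 * Real.pi * θ t x)| ≤ B₂ := by
    have h := h₂ t ht x
    simp only [Real.norm_eq_abs, Pi.mul_apply] at h
    rwa [e₂] at h
  have hi : (θ t x)⁻¹ ≤ B₃ := by
    have h := h₃ t ht x
    simp only [Real.norm_eq_abs, Pi.inv_apply] at h
    rw [e₂] at h
    exact (le_abs_self _).trans h
  have hwx : ‖u t x‖ ≤ W := by
    have h := h₄ t ht x
    rw [norm_norm, e₃] at h
    exact h
  have hl₁' := abs_le.1 hl₁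
  have hl₂' := abs_le.1 hl₂
  -- the quadratic term
  have hq0 : 0 ≤ ‖v - u t x‖ ^ 2 / (2 * θ t x) := by positivity
  have hsq : ‖v - u t x‖ ^ 2 ≤ 2 * ‖v‖ ^ 2 + 2 * W ^ 2 := by
    have h := norm_sub_le v (u t x)
    nlinarith [norm_nonneg v, norm_nonneg (u t x), norm_nonneg (v - u t x), sq_nonneg (‖v‖ - ‖u t x‖)]
  have hq : ‖v - u t x‖ ^ 2 / (2 * θ t x) ≤ (‖v‖ ^ 2 + W ^ 2) * B₃ := by
    rw [div_le_iff₀ (by positivity)]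
    have h1 : (‖v‖ ^ 2 + W ^ 2) * 1 ≤ (‖v‖ ^ 2 + W ^ 2) * (B₃ * θ t x) :=
      mul_le_mul_of_nonneg_left (by rwa [← div_le_iff₀ hθx, one_div]) (by positivity)
    nlinarith
  have hv0 : 0 ≤ ‖v‖ ^ 2 := sq_nonneg _
  rw [gExp, abs_le]
  constructor
  · nlinarith [mul_nonneg hB₁ hv0, mul_nonneg hB₂ hv0, mul_nonneg (mul_nonneg (sq_nonneg W) hB₃) hv0]
  · nlinarith [mul_nonneg hB₁ hv0, mul_nonneg hB₂ hv0, mul_nonneg (mul_nonneg (sq_nonneg W) hB₃) hv0,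
      mul_nonneg hB₃ hv0]

/-- Summed over the particles: `|Σ_i g_t(w_i)| ≤ C (N + 3) (1 + E(w))`, `E(w) = ½ Σ_i |v_i|²`
(`configEnergy`). [folklore] -/
theorem abs_gSum_le_of_window {N : ℕ} {C t : ℝ} (hC0 : 0 ≤ C)
    (hC : ∀ (x : T3) (v : V3), |gExp a θ u t (x, v)| ≤ C * (1 + ‖v‖ ^ 2)) (w : Config (N + 1) (Fin 3) T3) :
    |gSum a θ u t w| ≤ C * ((N : ℝ) + 3) * (1 + configEnergy w) := by
  have hE : configEnergy w = 2⁻¹ * ∑ i, ‖(w i).2‖ ^ 2 := rfl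
  have hS0 : 0 ≤ ∑ i, ‖(w i).2‖ ^ 2 := Finset.sum_nonneg fun i _ => by positivity
  calc |gSum a θ u t w| ≤ ∑ i, |gExp a θ u t (w i)| := Finset.abs_sum_le_sum_abs _ _
    _ ≤ ∑ i, C * (1 + ‖(w i).2‖ ^ 2) := Finset.sum_le_sum fun i _ => hC (w i).1 (w i).2
    _ = C * ((N : ℝ) + 1) + C * ∑ i, ‖(w i).2‖ ^ 2 := by
        rw [← Finset.mul_sum, Finset.sum_add_distrib, Finset.sum_const, Finset.card_univ,
          Fintype.card_fin, nsmul_eq_mul, mul_one, mul_add, Nat.cast_add, Nat.cast_one]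
    _ ≤ C * ((N : ℝ) + 3) * (1 + configEnergy w) := by rw [hE]; nlinarith [mul_nonneg hC0 hS0]

/-- **The clamped one-body observable is jointly continuous**: `(t, w) ↦ Σ_i g_{c(t)}(w_i)`,
`c(t) = max s (min t (s + h))`, for profiles jointly smooth on `[0, T) ⊇ [s, s+h]` with `a, θ > 0`. [folklore] -/
theorem continuous_gSum_clamp {N : ℕ} (ha : Torus.IsSmoothSpaceTimeOn (Ico 0 T) a)
    (hθ : Torus.IsSmoothSpaceTimeOn (Ico 0 T) θ) (hu : Torus.IsSmoothSpaceTimeOn (Ico 0 T) u)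
    (ha0 : ∀ t ∈ Ico 0 T, ∀ x, 0 < a t x) (hθ0 : ∀ t ∈ Ico 0 T, ∀ x, 0 < θ t x) {s h : ℝ}
    (hs : 0 ≤ s) (hh : 0 ≤ h) (hshT : s + h < T) :
    Continuous fun q : ℝ × Config (N + 1) (Fin 3) T3 => gSum a θ u (max s (min q.1 (s + h))) q.2 := by
  set c : ℝ → ℝ := fun t => max s (min t (s + h)) with hc_def
  have hcm : ∀ t, c t ∈ Ico 0 T := fun t =>
    ⟨hs.trans (le_max_left _ _), (max_le (le_add_of_nonneg_right hh) (min_le_right _ _)).trans_lt hshT⟩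
  have hq : IsOpenQuotientMap (Prod.map id Torus.proj : ℝ × V3 → ℝ × T3) :=
    IsOpenQuotientMap.id.prodMap Torus.isOpenQuotientMap_proj
  have hlift : Continuous fun p : ℝ × V3 => (c p.1, p.2) := by fun_prop
  have hA : Continuous fun p : ℝ × T3 => a (c p.1) p.2 := hq.continuous_comp_iff.1
    (ha.continuousOn_stLift.comp_continuous hlift fun p => mk_mem_prod (hcm p.1) (mem_univ _))
  have hΘ : Continuous fun p : ℝ × T3 => θ (c p.1) p.2 := hq.continuous_comp_iff.1
    (hθ.continuousOn_stLift.comp_continuous hlift fun p => mk_mem_prod (hcm p.1) (mem_univ _))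
  have hU : Continuous fun p : ℝ × T3 => u (c p.1) p.2 := hq.continuous_comp_iff.1
    (hu.continuousOn_stLift.comp_continuous hlift fun p => mk_mem_prod (hcm p.1) (mem_univ _))
  simp only [gSum, gExp]
  refine continuous_finsetSum _ fun i _ => ?_
  have hxi : Continuous fun q : ℝ × Config (N + 1) (Fin 3) T3 => (q.1, (q.2 i).1) := by fun_prop
  have hvi : Continuous fun q : ℝ × Config (N + 1) (Fin 3) T3 => (q.2 i).2 := by fun_prop
  have hA' : Continuous fun q : ℝ × Config (N + 1) (Fin 3) T3 => a (c q.1) (q.2 i).1 := hA.comp hxi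
  have hΘ' : Continuous fun q : ℝ × Config (N + 1) (Fin 3) T3 => θ (c q.1) (q.2 i).1 := hΘ.comp hxi
  have hU' : Continuous fun q : ℝ × Config (N + 1) (Fin 3) T3 => u (c q.1) (q.2 i).1 := hU.comp hxi
  have h1 : ∀ q : ℝ × Config (N + 1) (Fin 3) T3, a (c q.1) (q.2 i).1 ≠ 0 := fun q => (ha0 _ (hcm q.1) _).ne'
  have h2 : ∀ q : ℝ × Config (N + 1) (Fin 3) T3, 2 * Real.pi * θ (c q.1) (q.2 i).1 ≠ 0 := fun q =>
    (mul_pos Real.two_pi_pos (hθ0 _ (hcm q.1) _)).ne'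
  have h3 : ∀ q : ℝ × Config (N + 1) (Fin 3) T3, 2 * θ (c q.1) (q.2 i).1 ≠ 0 := fun q =>
    (mul_pos two_pos (hθ0 _ (hcm q.1) _)).ne'
  exact ((hA'.log h1).sub (continuous_const.mul ((continuous_const.mul hΘ').log h2))).sub
    (((hvi.sub hU').norm.pow 2).div (continuous_const.mul hΘ') h3)

/-- The clamped one-body observable is jointly measurable in `(t, w)`. [folklore] -/
theorem measurable_uncurry_gSum_clamp {N : ℕ} (ha : Torus.IsSmoothSpaceTimeOn (Ico 0 T) a)
    (hθ : Torus.IsSmoothSpaceTimeOn (Ico 0 T) θ) (hu : Torus.IsSmoothSpaceTimeOn (Ico 0 T) u)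
    (ha0 : ∀ t ∈ Ico 0 T, ∀ x, 0 < a t x) (hθ0 : ∀ t ∈ Ico 0 T, ∀ x, 0 < θ t x) {s h : ℝ}
    (hs : 0 ≤ s) (hh : 0 ≤ h) (hshT : s + h < T) :
    Measurable (Function.uncurry fun (t : ℝ) (w : Config (N + 1) (Fin 3) T3) =>
      gSum a θ u (max s (min t (s + h))) w) :=
  (continuous_gSum_clamp ha hθ hu ha0 hθ0 hs hh hshT).measurable

/-- The one-body sum at a fixed time of the window is measurable in the state. [folklore] -/
theorem measurable_gSum_of_mem {N : ℕ} (ha : Torus.IsSmoothSpaceTimeOn (Ico 0 T) a)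
    (hθ : Torus.IsSmoothSpaceTimeOn (Ico 0 T) θ) (hu : Torus.IsSmoothSpaceTimeOn (Ico 0 T) u)
    (ha0 : ∀ t ∈ Ico 0 T, ∀ x, 0 < a t x) (hθ0 : ∀ t ∈ Ico 0 T, ∀ x, 0 < θ t x) {s h : ℝ}
    (hs : 0 ≤ s) (hh : 0 ≤ h) (hshT : s + h < T) {t : ℝ} (ht : t ∈ Icc s (s + h)) :
    Measurable fun w : Config (N + 1) (Fin 3) T3 => gSum a θ u t w := by
  have hclamp : max s (min t (s + h)) = t := by rw [min_eq_left ht.2, max_eq_right ht.1]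
  have e : (fun w : Config (N + 1) (Fin 3) T3 => gSum a θ u t w) =
      (Function.uncurry fun (t' : ℝ) (w : Config (N + 1) (Fin 3) T3) => gSum a θ u (max s (min t' (s + h))) w) ∘
        fun w => (t, w) := by
    funext w
    simp only [Function.comp_apply, Function.uncurry_apply_pair, hclamp]
  rw [e]
  exact (measurable_uncurry_gSum_clamp ha hθ hu ha0 hθ0 hs hh hshT).comp (measurable_const.prodMk measurable_id)

end Window

/-! ## §3 The two-time law in Bochner form -/

section TwoTime

/-- **The two-time Markov law of the Lambertian gas, Bochner form.** For `0 < ε < 1/2`, a finite initial law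
`P ≪ liouville` of `N` spheres on `𝕋³`, `s, h ≥ 0` and a real measurable `F` on pairs of states,
`∫ F(q, Λ_h(q, ηs)) d(μ_s ⊗ γ^ℕ) = ∫ F(Λ_s, Λ_{s+h}) d(P ⊗ γ^ℕ)`, `μ_s = (P ⊗ γ^ℕ) ∘ Λ_s⁻¹`: the two joint laws
agree (`stub_twoTimeLawLambda` tested on indicators / `Measure.ext_of_lintegral`), then `integral_map` twice. [folklore] -/
theorem integral_twoTime_eq : ∀ {N : ℕ} {ε : ℝ}, 0 < ε → ε < 2⁻¹ → ∀ (P : Measure (Config N (Fin 3) T3)) [IsFiniteMeasure P], P ≪ liouville (Torus.geometry (Fin 3)) N ε → ∀ {s h : ℝ}, 0 ≤ s → 0 ≤ h → ∀ {F : Config N (Fin 3) T3 × Config N (Fin 3) T3 → ℝ}, Measurable F → ∫ q, F (q.1, lambertFlow (Torus.geometry (Fin 3)) ε q.2 q.1 h) ∂(((P.prod (lambertNoise (Fin 3))).map (fun p => lambertFlow (Torus.geometry (Fin 3)) ε p.2 p.1 s)).prod (lambertNoise (Fin 3))) = ∫ p, F (lambertFlow (Torus.geometry (Fin 3)) ε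 p.2 p.1 s, lambertFlow (Torus.geometry (Fin 3)) ε p.2 p.1 (s + h)) ∂(P.prod (lambertNoise (Fin 3))) := by
  intro N ε hε hε' P _ hP s h hs hh F hF
  have hΛ := fun t => measurable_lambertFlow_torus (d := Fin 3) (N := N) hε' t
  set Ψ₁ : Config N (Fin 3) T3 × (ℕ → V3) → Config N (Fin 3) T3 × Config N (Fin 3) T3 :=
    fun q => (q.1, lambertFlow (Torus.geometry (Fin 3)) ε q.2 q.1 h) with hΨ₁
  set Ψ₂ : Config N (Fin 3) T3 × (ℕ → V3) → Config N (Fin 3) T3 × Config N (Fin 3) T3 :=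
    fun p => (lambertFlow (Torus.geometry (Fin 3)) ε p.2 p.1 s,
      lambertFlow (Torus.geometry (Fin 3)) ε p.2 p.1 (s + h)) with hΨ₂
  have hΨ₁m : Measurable Ψ₁ := measurable_fst.prodMk (hΛ h)
  have hΨ₂m : Measurable Ψ₂ := (hΛ s).prodMk (hΛ (s + h))
  set ν := ((P.prod (lambertNoise (Fin 3))).map
    (fun p => lambertFlow (Torus.geometry (Fin 3)) ε p.2 p.1 s)).prod (lambertNoise (Fin 3)) with hν
  have hlaw : ν.map Ψ₁ = (P.prod (lambertNoise (Fin 3))).map Ψ₂ := by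
    refine Measure.ext_of_lintegral _ fun f hf => ?_
    rw [lintegral_map hf hΨ₁m, lintegral_map hf hΨ₂m]
    exact (LambertianContactSwapLambertianEulerTwoTimeLaw.stub_twoTimeLawLambda hε hε' N P hP s h hs hh hf).symm
  have e₁ : ∫ w, F w ∂(ν.map Ψ₁) = ∫ q, F (Ψ₁ q) ∂ν := integral_map hΨ₁m.aemeasurable hF.aestronglyMeasurable
  have e₂ : ∫ w, F w ∂((P.prod (lambertNoise (Fin 3))).map Ψ₂) = ∫ p, F (Ψ₂ p) ∂(P.prod (lambertNoise (Fin 3))) :=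
    integral_map hΨ₂m.aemeasurable hF.aestronglyMeasurable
  rw [hlaw] at e₁
  exact e₁.symm.trans e₂

end TwoTime

end Summit.AtomisticToContinuum.HydrodynamicLimit.Theorems.LambertianContactSwapLambertianEulerExpectedWindowProductionTools

end
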